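import Summits.BirchSwinnertonDyer.BirchSwinnertonDyer.Theorems.ThetaPartnerAtTwoSignedControlAtTwoPlusLocShift
import Summits.BirchSwinnertonDyer.BirchSwinnertonDyer.Theorems.ResidualThetaTransportAtTwoRlfTwistedLocalZpExtension
import Literature.NumberTheory.EllipticCurves.ZpExtensionGaloisTwistLocal
import Literature.NumberTheory.EllipticCurves.KummerSelmerStructure
import Literature.NumberTheory.GaloisRepresentations.ContinuousCohomologyConnecting
import Literature.NumberTheory.GaloisRepresentations.ContinuousH1ResCocycle
import HarnessLib

/-!
# Road T for item 23110, brick (R3) = (T2)⁺ part 1′: the TWISTED `±`-local lift from a twisted SHIFT datum, MODULO the twisted local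
# Kummer condition — `…RlfTwistedPlusLocShift` strengthened to the shape a Prop. 4.13-type surjectivity «mod `L⁺`» consumes

Route `ResidualThetaTransportAtTwo` (RTT, crux r201 `ResidualLambdaFormulaNegDiscAtTwo`, stmt-BirchSwinnertonDyer-23110) /
`ThetaPartnerAtTwo` (TP2). Seat `prover-bsd-wall-tp2-p2x-w3` g12; `--supports stmt-BirchSwinnertonDyer-23110`. THEOREMS ONLY (no
definition, no named fact, no `sorry`); route-independent; closes nothing.

WHY (lead memo RLF-TWIST-ROAD-g12 §3 (R3)): the twisted lifting package (LIFT⁺₂) of road T needs, at the place `w ∋ 2` of `K_∞`, the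
`χ_u`-twisted analogue of Greenberg's Lemma 4.7 lift for the `+` Kummer condition: «a class `t ∈ H¹(K_∞, E[p^∞])` whose twisted
coboundary `u·conj_g t − t` is Kummer from `A = ⋃ₙ E⁺_n` comes, modulo the `+` condition, from a class of the finite twisted module
`E[p^J](χ_u)` at level `K_v`». K4's untwisted engine splits into part 7 (SHIFT ⟹ LIFT: `cd_p ℤ_p = 1` + Kummer descent) and part 8
(coinvariants ⟹ SHIFT). THIS FILE is the twisted part 7; the output lives in the lead's (TCAS-K) currency
`galoisCohomology ((twistedTorsionGaloisModule p κ J u hu).restrictField K_v) 1` and is compared with GLOBAL twisted classes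
through `galoisCohomology.res` / `twistedTorsionToH1`:

* `exists_twistedTorsion_localLift_kummer_of_shift_mod` — any number field `K`, `W/K`, prime `p`, `ℤ_p`-extension `κ`, completion-type
  field `E/K` with `g ∈ Γ_E` restricting to THE topological generator of `κ`, `u ≡ 1 (mod p)`, `A ≤ E(K_∞·E)`: from a cocycle `φ` of
  a class `t` of `H¹(K_∞, E[p^∞])`, a point `S` with `p^j S ∈ A` and a `p`-power-torsion `T` such that the shifted local values
  `f₁(τ) = ι φ(τ|) − (τS − S)` on `G_∞ = Gal(K̄_E/K_∞·E)` satisfy the TWISTED relation `u·g f₁(g⁻¹τg) − f₁(τ) = τT − T`, produce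
  `J₀` and, for every `J ≥ J₀`, a class `x ∈ H¹(Γ_E, E[p^J](χ_u))` such that for every GLOBAL `y ∈ H¹(Γ_K, E[p^J](χ_u))` whose
  `res_E y − x` is TWISTED-KUMMER-from-`A` (represented by a cocycle `ζ` with `ι ζ(τ) = τQ − Q` on `G_∞`, `p^m Q ∈ A` — the local `+`
  condition at level `J`, the lead's (D1) `twistedTorsionLocalKummer`): `t − twistedTorsionToH1 y ∈ localKummerOverOfEmb W p (ker κ)
  (closureEmb E) A`. (The exact version `…RlfTwistedPlusLocShift.exists_twistedTorsion_localLift_kummer_of_shift` is `ζ = 0`.)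
  Steps (cocycles throughout): the values of `f₁` and `T` are killed by `p^{J₀}` (compactness of `Gal(K̄/K_∞)`, `p^j S ∈ A` is
  `G_∞`-fixed); for `J ≥ J₀` transport them into `E[p^J](K̄) ≃ E(K̄_E)[p^J]` (`torsionPointsEquiv`) with the TWISTED `Γ_E`-action
  (`χ_u ≡ 1` on `G_∞`, `χ_u(g) = u`: `twistExponent_eq_mod_of_apply_eq`); the relation is the hypothesis of the tree's
  `ZpExtension.exists_extend` for the local `ℤ_p`-extension (`SSFlatEC.exists_localZpExtension_of_isTopGenerator`); the extended
  twisted cocycle is `x`; if `res_E y = x` (`galoisCohomology.res_oneCocycleClass`) the two level-`E` cocycles differ by a twisted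
  coboundary `∂P`, `P ∈ E[p^J]`, and on `G_∞` the cocycle of `t − twistedTorsionToH1 y` (`twistedTorsionToH1_oneCocycleClass`) has
  local values `∂(S − ι P)` with `p^{J+j}(S − ι P) ∈ A`.

HONEST FRAMING: closes nothing; 23110 is NOT proved; BSD is not proved by any of this.
References: [GreenbergLNM1716] §3 Lemma 3.2 (p. 86), §4 Lemma 4.7 (pp. 107–108), p. 124; [BDKim2013] Props. 2.2–2.3, proof of Cor. 3.15;
[SerreGaloisCohomology1997] I §2.6, I §5.8; [Kobayashi2003] Def. 1.1.
-/

set_option autoImplicit false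
-- the Theorems namespace of this sub repeats the summit name by design (D-0017 nested layout)
set_option linter.dupNamespace false

noncomputable section

open scoped Classical NumberField

open NumberField IsDedekindDomain CategoryTheory

universe u

namespace Summit.BirchSwinnertonDyer.BirchSwinnertonDyer.Theorems.SignedEC.TwistedLocalDescent

open Literature.NumberTheory.EllipticCurves Literature.NumberTheory.GaloisRepresentations
  WeierstrassCurve ZpExtension Literature.NumberTheory.EllipticCurves.Kobayashi2003
  Literature.NumberTheory.EllipticCurves.Sprung2012

variable {K : Type u} [Field K] [NumberField K] (W : WeierstrassCurve K) [W.IsElliptic] {p : ℕ} [Fact p.Prime]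
  (κ : ZpExtension K p) (E : Type u) [Field E] [Algebra K E]

set_option maxHeartbeats 3200000 in
/-- **The twisted `±`-local lift from a twisted SHIFT datum** (the `χ_u`-twin of `SignedEC.exists_localLift_kummer_of_shift`).
See the module docstring. [cite: GreenbergLNM1716, §3 Lemma 3.2 (p. 86), §4 Lemma 4.7 (pp. 107–108), p. 124]
[cite: BDKim2013, Props. 2.2–2.3] [cite: SerreGaloisCohomology1997, I §5.8] -/
theorem exists_twistedTorsion_localLift_kummer_of_shift_mod
    (A : AddSubgroup (localPoints W E))
    (hAM : A ≤ localTowerPointsOfEmb κ (closureEmb (K := K) E) W)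
    {g : Field.absoluteGaloisGroup E} (hg : κ.IsTopGenerator (resGal (K := K) E g))
    {u : ℤ} (hu : (p : ℤ) ∣ u - 1)
    (φ : contOneCocycles (discreteTopRep κ.kerSubgroup (W.geomPrimaryTorsion p)))
    (S T : localPoints W E) (hSA : ∃ j : ℕ, p ^ j • S ∈ A) (hTt : ∃ n : ℕ, p ^ n • T = 0)
    (hshift : ∀ τ τ' : localSubgroupOfEmb κ.kerSubgroup (closureEmb (K := K) E),
      (τ' : Field.absoluteGaloisGroup E) = g⁻¹ * τ * g →
      u • g • (pointsMapOfEmb W (closureEmb (K := K) E)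
          ((φ.1 ⟨resGalOfEmb (closureEmb (K := K) E) τ', τ'.2⟩ : W.geomPrimaryTorsion p) : W.geomPoints) -
        ((τ' : Field.absoluteGaloisGroup E) • S - S)) -
      (pointsMapOfEmb W (closureEmb (K := K) E)
          ((φ.1 ⟨resGalOfEmb (closureEmb (K := K) E) τ, τ.2⟩ : W.geomPrimaryTorsion p) : W.geomPoints) -
        ((τ : Field.absoluteGaloisGroup E) • S - S)) = (τ : Field.absoluteGaloisGroup E) • T - T) :
    ∃ J₀ : ℕ, ∀ J : ℕ, J₀ ≤ J →
      ∃ x : galoisCohomology ((W.twistedTorsionGaloisModule p κ J u hu).restrictField E) 1,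
        ∀ y : galoisCohomology (W.twistedTorsionGaloisModule p κ J u hu) 1,
          (∃ (ζ : contOneCocycles ((W.twistedTorsionGaloisModule p κ J u hu).restrictField E).toTopRep)
              (Q : localPoints W E) (m : ℕ),
            oneCocycleClass _ ζ = galoisCohomology.res (W.twistedTorsionGaloisModule p κ J u hu) E 1 y - x ∧
            p ^ m • Q ∈ A ∧
            ∀ τ : localSubgroupOfEmb κ.kerSubgroup (closureEmb (K := K) E),
              pointsMap W E ((ζ.1 (τ : Field.absoluteGaloisGroup E) : geomTorsion W ((p ^ J : ℕ) : ℤ)) : geomPoints W) =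
                (τ : Field.absoluteGaloisGroup E) • Q - Q) →
          oneCocycleClass _ φ - W.twistedTorsionToH1 p κ J u hu y ∈
            localKummerOverOfEmb W p κ.kerSubgroup (closureEmb (K := K) E) A := by
  -- notation and generalities (as in `SignedEC.exists_localLift_kummer_of_shift`)
  set ι : AlgebraicClosure K →ₐ[K] AlgebraicClosure E := closureEmb (K := K) E with hι
  set M : AddSubgroup (localPoints W E) := localTowerPointsOfEmb κ ι W with hM
  have hMfix : ∀ {P : localPoints W E}, P ∈ M →
      ∀ τ : Field.absoluteGaloisGroup E, τ ∈ localSubgroupOfEmb κ.kerSubgroup ι → τ • P = P :=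
    fun {P} hP ↦ (mem_localTowerPointsOfEmb_iff κ ι W P).1 hP
  have hconj : ∀ (σ τ : Field.absoluteGaloisGroup E), τ ∈ localSubgroupOfEmb κ.kerSubgroup ι →
      σ⁻¹ * τ * σ ∈ localSubgroupOfEmb κ.kerSubgroup ι := by
    intro σ τ hτ
    rw [mem_localSubgroupOfEmb_iff] at hτ ⊢
    rw [map_mul, map_mul, map_inv]
    exact κ.kerSubgroup_normal.conj_mem' _ hτ _
  have hGmem : ∀ {u : Field.absoluteGaloisGroup E}, u ∈ localSubgroupOfEmb κ.kerSubgroup ι →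
      resGalOfEmb ι u ∈ κ.kerSubgroup := fun {u} hu ↦ (mem_localSubgroupOfEmb_iff _ ι u).1 hu
  have galois_smul_nsmul : ∀ (τ : Field.absoluteGaloisGroup E) (n : ℕ) (P : localPoints W E),
      τ • (n • P) = n • (τ • P) := fun τ n P ↦ map_nsmul (DistribSMul.toAddMonoidHom (localPoints W E) τ) n P
  have galois_smul_zsmul : ∀ (τ : Field.absoluteGaloisGroup E) (n : ℤ) (P : localPoints W E),
      τ • (n • P) = n • (τ • P) := fun τ n P ↦ map_zsmul (DistribSMul.toAddMonoidHom (localPoints W E) τ) n P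
  -- the local values `f0` of `φ` on `G_∞ = Gal(K̄_E/K_∞·E)`
  obtain ⟨f0, hf0⟩ : ∃ f0 : ∀ u : Field.absoluteGaloisGroup E, u ∈ localSubgroupOfEmb κ.kerSubgroup ι →
      localPoints W E, ∀ u hu, f0 u hu =
      pointsMapOfEmb W ι ((φ.1 ⟨resGalOfEmb ι u, hGmem hu⟩ : W.geomPrimaryTorsion p) : W.geomPoints) :=
    ⟨_, fun _ _ ↦ rfl⟩
  have hf0mul : ∀ (σ τ : Field.absoluteGaloisGroup E) (hσ : σ ∈ localSubgroupOfEmb κ.kerSubgroup ι)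
      (hτ : τ ∈ localSubgroupOfEmb κ.kerSubgroup ι),
      f0 (σ * τ) (mul_mem hσ hτ) = f0 σ hσ + σ • f0 τ hτ := by
    intro σ τ hσ hτ
    have hst : (⟨resGalOfEmb ι (σ * τ), hGmem (mul_mem hσ hτ)⟩ : κ.kerSubgroup) =
        ⟨resGalOfEmb ι σ, hGmem hσ⟩ * ⟨resGalOfEmb ι τ, hGmem hτ⟩ := Subtype.ext (map_mul _ _ _)
    have h := φ.2 ⟨resGalOfEmb ι σ, hGmem hσ⟩ ⟨resGalOfEmb ι τ, hGmem hτ⟩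
    rw [hf0 (σ * τ) (mul_mem hσ hτ), hf0 σ hσ, hf0 τ hτ, hst, h, AddSubgroup.coe_add, map_add,
      discreteTopRep_ρ_apply, Subgroup.smul_def, primaryComponent.coe_smul, pointsMapOfEmb_smul]
  -- a UNIFORM torsion bound for `φ` (compactness of `Gal(K̄/K_∞)`)
  haveI : CompactSpace (Field.absoluteGaloisGroup K) := absoluteGaloisGroup_compactSpace K
  haveI : CompactSpace κ.kerSubgroup := isCompact_iff_compactSpace.mp κ.isClosed_kerSubgroup.isCompact
  have hφtors : ∀ h : κ.kerSubgroup, ∃ n : ℕ, p ^ n • φ.1 h = 0 := fun h ↦ by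
    obtain ⟨n, hn⟩ := AddCommGroup.mem_primaryComponent.mp (φ.1 h).2
    exact ⟨n, Subtype.ext (by rw [AddSubmonoidClass.coe_nsmul, hn, ZeroMemClass.coe_zero])⟩
  obtain ⟨N₀, hN₀⟩ := exists_pow_smul_apply_eq_zero φ.1 hφtors
  have hf0tors : ∀ u hu, p ^ N₀ • f0 u hu = 0 := fun u hu ↦ by
    rw [hf0 u hu, ← map_nsmul, ← AddSubmonoidClass.coe_nsmul, hN₀, ZeroMemClass.coe_zero, map_zero]
  -- the modified local values `f1 τ = f0 τ − (τ S − S)` on `G_∞`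
  have hgconj_mem : ∀ {τ : Field.absoluteGaloisGroup E}, τ ∈ localSubgroupOfEmb κ.kerSubgroup ι →
      g⁻¹ * τ * g ∈ localSubgroupOfEmb κ.kerSubgroup ι := fun {τ} hτ ↦ hconj g τ hτ
  obtain ⟨j, hjS⟩ := hSA
  obtain ⟨n₀, hn₀⟩ := hTt
  have hSfix : ∀ {τ : Field.absoluteGaloisGroup E}, τ ∈ localSubgroupOfEmb κ.kerSubgroup ι →
      p ^ j • (τ • S - S) = 0 := fun {τ} hτ ↦ by
    rw [smul_sub, smul_comm (p ^ j) τ S, hMfix (hAM hjS) τ hτ, sub_self]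
  let f1 : ∀ τ : Field.absoluteGaloisGroup E, τ ∈ localSubgroupOfEmb κ.kerSubgroup ι → localPoints W E :=
    fun τ hτ ↦ f0 τ hτ - (τ • S - S)
  have hf1def : ∀ τ hτ, f1 τ hτ = f0 τ hτ - (τ • S - S) := fun _ _ ↦ rfl
  -- (i) uniform torsion: `p^{N₀+j} f1 = 0`
  have hf1tors : ∀ τ hτ, p ^ (N₀ + j) • f1 τ hτ = 0 := fun τ hτ ↦ by
    rw [hf1def, smul_sub, pow_add, mul_comm, mul_smul, hf0tors, smul_zero, mul_comm, mul_smul, hSfix hτ, smul_zero,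
      sub_zero]
  -- (ii) cocycle identity
  have hf1mul : ∀ (σ τ : Field.absoluteGaloisGroup E) (hσ : σ ∈ localSubgroupOfEmb κ.kerSubgroup ι)
      (hτ : τ ∈ localSubgroupOfEmb κ.kerSubgroup ι),
      f1 (σ * τ) (mul_mem hσ hτ) = f1 σ hσ + σ • f1 τ hτ := by
    intro σ τ hσ hτ
    rw [hf1def, hf1def, hf1def, hf0mul σ τ hσ hτ, mul_smul, smul_sub, smul_sub]
    abel
  -- (iii) TWISTED `g`-invariance up to the coboundary of the torsion point `T`
  have hf1conj : ∀ (τ : Field.absoluteGaloisGroup E) (hτ : τ ∈ localSubgroupOfEmb κ.kerSubgroup ι),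
      u • g • f1 (g⁻¹ * τ * g) (hgconj_mem hτ) - f1 τ hτ = τ • T - T := by
    intro τ hτ
    rw [hf1def, hf1def, hf0 _ (hgconj_mem hτ), hf0 τ hτ]
    exact hshift ⟨τ, hτ⟩ ⟨g⁻¹ * τ * g, hgconj_mem hτ⟩ rfl
  -- the local `ℤ_p`-extension `κ_E` (kernel `G_∞`, generator `g`)
  obtain ⟨κE, hker, hγE⟩ := SSFlatEC.exists_localZpExtension_of_isTopGenerator κ E hg
  have hmemE : ∀ {τ : Field.absoluteGaloisGroup E}, τ ∈ κE.kerSubgroup →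
      τ ∈ localSubgroupOfEmb κ.kerSubgroup ι := fun {τ} hτ ↦ by rw [hker] at hτ; exact hτ
  have hmemE' : ∀ {τ : Field.absoluteGaloisGroup E}, τ ∈ localSubgroupOfEmb κ.kerSubgroup ι →
      τ ∈ κE.kerSubgroup := fun {τ} hτ ↦ by rw [hker]; exact hτ
  haveI : CharZero E := charZero_of_injective_algebraMap (algebraMap K E).injective
  -- THE LEVEL `J ≥ J₀ := N₀ + j + n₀`
  refine ⟨N₀ + j + n₀, fun J hJ ↦ ?_⟩
  have hpJ : ((p ^ J : ℕ) : ℤ) ≠ 0 := by exact_mod_cast pow_ne_zero _ (Fact.out : p.Prime).ne_zero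
  have hf1J : ∀ τ hτ, f1 τ hτ ∈ AddSubgroup.torsionBy (localPoints W E) ((p ^ J : ℕ) : ℤ) := fun τ hτ ↦
    AddSubgroup.torsionBy.nsmul_iff.mpr (by
      rw [show J = (J - (N₀ + j)) + (N₀ + j) by omega, pow_add, mul_smul, hf1tors, smul_zero])
  have hTJ : T ∈ AddSubgroup.torsionBy (localPoints W E) ((p ^ J : ℕ) : ℤ) :=
    AddSubgroup.torsionBy.nsmul_iff.mpr (by
      rw [show J = (J - n₀) + n₀ by omega, pow_add, mul_smul, hn₀, smul_zero])
  -- the twisted finite module at level `E`, as a LOCAL instance on `E[p^J](K̄)`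
  let MJ : Type u := ↥(geomTorsion W ((p ^ J : ℕ) : ℤ))
  let θ : MJ ≃+ AddSubgroup.torsionBy (localPoints W E) ((p ^ J : ℕ) : ℤ) :=
    W.torsionPointsEquiv ((p ^ J : ℕ) : ℤ) (E := E) hpJ
  let ρE := (W.twistedTorsionGaloisModule p κ J u hu).restrictField E
  letI instMJ : DistribMulAction (Field.absoluteGaloisGroup E) MJ := DistribMulAction.compHom MJ ρE.toRepresentation
  have hsmulM : ∀ (σ : Field.absoluteGaloisGroup E) (m : MJ),
      σ • m = (u ^ κ.twistExponent J (resGal (K := K) E σ)) • (resGal (K := K) E σ • m) := fun σ m ↦ by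
    show (W.twistedTorsionGaloisModule p κ J u hu) (resGal (K := K) E σ) m = _
    rw [ZpExtension.galoisTwist_apply_apply, torsionGaloisModule_apply_apply]
  have hMtors : ∀ m : MJ, p ^ J • m = 0 := W.pow_nsmul_geomTorsion_pow p J
  have hsmulH : ∀ (τ : Field.absoluteGaloisGroup E), τ ∈ localSubgroupOfEmb κ.kerSubgroup ι → ∀ m : MJ,
      τ • m = resGal (K := K) E τ • m := fun τ hτ m ↦ by
    have hτ' : resGal (K := K) E τ ∈ κ.kerSubgroup := hGmem hτ
    rw [hsmulM, κ.twistExponent_eq_zero_of_mem_kerSubgroup hτ', pow_zero, one_smul]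
  have hsmulg : ∀ m : MJ, g • m = u • (resGal (K := K) E g • m) := fun m ↦ by
    rw [hsmulM, twistExponent_eq_mod_of_apply_eq κ J (N := 1) (by rw [Nat.cast_one]; exact hg),
      ZpExtension.pow_mod_zsmul_eq hMtors hu, pow_one]
  have hθ : ∀ (σ : Field.absoluteGaloisGroup E) (Tm : AddSubgroup.torsionBy (localPoints W E) ((p ^ J : ℕ) : ℤ)),
      θ.symm (σ • Tm) = resGal (K := K) E σ • θ.symm Tm := fun σ Tm ↦ W.torsionPointsEquiv_symm_smul _ hpJ σ Tm
  have hθval : ∀ Tm : AddSubgroup.torsionBy (localPoints W E) ((p ^ J : ℕ) : ℤ),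
      pointsMap W E ((θ.symm Tm : MJ) : geomPoints W) = (Tm : localPoints W E) :=
    fun Tm ↦ W.pointsMap_torsionPointsEquiv_symm _ hpJ Tm
  have hcontM : ∀ m : MJ, Continuous fun σ : Field.absoluteGaloisGroup E ↦ σ • m := fun m ↦ ρE.continuous_apply_left m
  have hprimM : ∀ m : MJ, ∃ n : ℕ, p ^ n • m = 0 := fun m ↦ ⟨J, hMtors m⟩
  -- the `MJ`-valued twisted cocycle `cT` on `ker κE = G_∞`
  have hkE : ∀ τ : κE.kerSubgroup, (τ : Field.absoluteGaloisGroup E) ∈ localSubgroupOfEmb κ.kerSubgroup ι :=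
    fun τ ↦ hmemE τ.2
  have hf1cont : Continuous fun τ : κE.kerSubgroup ↦ f1 τ (hkE τ) := by
    have hfun : (fun τ : κE.kerSubgroup ↦ f1 τ (hkE τ)) = fun τ : κE.kerSubgroup ↦
        pointsMapOfEmb W ι ((φ.1 ⟨resGalOfEmb ι τ.1, hGmem (hkE τ)⟩ : W.geomPrimaryTorsion p) : W.geomPoints) -
          ((τ : Field.absoluteGaloisGroup E) • S - S) := by
      funext τ; rw [hf1def, hf0]
    rw [hfun]
    refine Continuous.sub ?_ (((continuous_smul_localPoints W E S).comp continuous_subtype_val).sub continuous_const)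
    have h1 : Continuous fun τ : κE.kerSubgroup ↦ (⟨resGalOfEmb ι τ.1, hGmem (hkE τ)⟩ : κ.kerSubgroup) :=
      ((map_continuous (resGalOfEmb ι)).comp continuous_subtype_val).subtype_mk _
    exact (continuous_of_discreteTopology (α := W.geomPrimaryTorsion p)
      (f := fun x ↦ pointsMapOfEmb W ι (x : W.geomPoints))).comp (φ.1.continuous.comp h1)
  let fT : κE.kerSubgroup → AddSubgroup.torsionBy (localPoints W E) ((p ^ J : ℕ) : ℤ) :=
    fun τ ↦ ⟨f1 τ (hkE τ), hf1J τ (hkE τ)⟩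
  have hfTcont : Continuous fT := hf1cont.subtype_mk _
  let cT : contOneCocycles (discreteTopRep κE.kerSubgroup MJ) :=
    ⟨⟨fun τ ↦ θ.symm (fT τ), (continuous_of_discreteTopology (f := θ.symm)).comp hfTcont⟩, fun σ τ ↦ by
      change θ.symm (fT (σ * τ)) = θ.symm (fT σ) + (σ : Field.absoluteGaloisGroup E) • θ.symm (fT τ)
      rw [hsmulH _ (hkE σ), ← hθ, ← map_add]
      congr 1
      apply Subtype.ext
      rw [AddSubgroup.coe_add, AddSubgroup.torsionBy.coe_smul]
      exact hf1mul σ τ (hkE σ) (hkE τ)⟩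
  have hcT : ∀ τ : κE.kerSubgroup, cT.1 τ = θ.symm (fT τ) := fun _ ↦ rfl
  let mT : MJ := θ.symm ⟨T, hTJ⟩
  have hm : ∀ τ : κE.kerSubgroup, g ^ p ^ 0 • cT.1 (subgroupConj κE.kerSubgroup (g ^ p ^ 0) τ) - cT.1 τ =
      (τ : Field.absoluteGaloisGroup E) • mT - mT := by
    intro τ
    have hg1 : g ^ p ^ 0 = g := by rw [pow_zero, pow_one]
    have hconjτ : subgroupConj κE.kerSubgroup (g ^ p ^ 0) τ =
        ⟨g⁻¹ * τ * g, hmemE' (hgconj_mem (hkE τ))⟩ := Subtype.ext (by rw [subgroupConj_apply_coe, hg1])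
    rw [hconjτ, hg1, hcT, hcT, hsmulg, hsmulH _ (hkE τ), ← hθ, ← hθ, ← map_zsmul, ← map_sub, ← map_sub]
    congr 1
    apply Subtype.ext
    rw [AddSubgroup.coe_sub, AddSubgroup.coe_sub, AddSubgroupClass.coe_zsmul, AddSubgroup.torsionBy.coe_smul,
      AddSubgroup.torsionBy.coe_smul]
    exact hf1conj τ (hkE τ)
  obtain ⟨bc, hbc⟩ := ZpExtension.exists_extend κE hγE 0 hcontM hprimM cT mT hm
  -- the extended cocycle as a cocycle `ξ` of the twisted local module on all of `Γ_E`
  have htop : ∀ σ : Field.absoluteGaloisGroup E, σ ∈ κE.layerSubgroup 0 := fun σ ↦ by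
    rw [ZpExtension.layerSubgroup_zero]; exact Subgroup.mem_top σ
  let ξ : contOneCocycles ρE.toTopRep :=
    ⟨⟨fun σ ↦ (bc.1 ⟨σ, htop σ⟩ : MJ), bc.1.continuous.comp (continuous_id.subtype_mk _)⟩, fun σ τ ↦ by
      change bc.1 ⟨σ * τ, htop _⟩ = bc.1 ⟨σ, htop σ⟩ + ρE.toTopRep.ρ σ (bc.1 ⟨τ, htop τ⟩)
      rw [ContinuousRep.toTopRep_ρ_apply]
      have h := bc.2 ⟨σ, htop σ⟩ ⟨τ, htop τ⟩
      rw [discreteTopRep_ρ_apply, Subgroup.smul_def] at h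
      exact h⟩
  have hξG : ∀ (τ : Field.absoluteGaloisGroup E) (hτ : τ ∈ localSubgroupOfEmb κ.kerSubgroup ι),
      pointsMap W E ((ξ.1 τ : MJ) : geomPoints W) = f1 τ hτ := by
    intro τ hτ
    change pointsMap W E (((bc.1 ⟨τ, htop τ⟩ : MJ)) : geomPoints W) = _
    have e3 : (⟨τ, κE.kerSubgroup_le_layerSubgroup 0 (hmemE' hτ)⟩ : κE.layerSubgroup 0) = ⟨τ, htop τ⟩ := rfl
    rw [← e3, hbc τ (hmemE' hτ), hcT, hθval]
  refine ⟨oneCocycleClass _ ξ, fun y ⟨ζ, Qζ, mζ, hζ, hQζ, hζval⟩ ↦ ?_⟩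
  -- Step D: `t − twistedTorsionToH1 y` is Kummer-from-`A` whenever `res_E y − x` is twisted-Kummer-from-`A`
  obtain ⟨Y, rfl⟩ := oneCocycleClass_surjective _ y
  rw [galoisCohomology.res_oneCocycleClass] at hζ
  have hy0 : oneCocycleClass ρE.toTopRep (contOneCocycles.pullback (absGaloisRestrict K E)
      (TopRep.ofHom ⟨ContinuousLinearMap.id ℤ MJ, fun _ => rfl⟩ :
        TopRep.res (absGaloisRestrict K E : Field.absoluteGaloisGroup E →* Field.absoluteGaloisGroup K)
          (W.twistedTorsionGaloisModule p κ J u hu).toTopRep ⟶ DiscreteGaloisModule.toTopRep ρE) Y - ξ - ζ) = 0 := by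
    rw [oneCocycleClass_sub, oneCocycleClass_sub]
    exact sub_eq_zero.mpr hζ.symm
  rw [oneCocycleClass_eq_zero_iff] at hy0
  obtain ⟨P, hP⟩ := hy0
  -- `Y(σ|) − ξ(σ) − ζ(σ) = σ •_tw P − P` on `Γ_E`
  have hP' : ∀ σ : Field.absoluteGaloisGroup E, Y.1 (resGal (K := K) E σ) - ξ.1 σ - ζ.1 σ = σ • P - P := fun σ ↦ by
    have h := hP σ
    rw [Submodule.coe_sub, Submodule.coe_sub, ContinuousMap.sub_apply, ContinuousMap.sub_apply,
      galoisCohomology.pullback_absGaloisRestrict_apply, ContinuousRep.toTopRep_ρ_apply] at h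
    exact h
  -- the Kummer point `Q₂ = S − ι P`
  set ιP : localPoints W E := pointsMap W E ((P : MJ) : geomPoints W) with hιP
  have hιPJ : p ^ J • ιP = 0 := by
    rw [hιP, ← map_nsmul, ← AddSubgroupClass.coe_nsmul, hMtors, ZeroMemClass.coe_zero, map_zero]
  have hQ₂A : p ^ (J + j + mζ) • (S - ιP - Qζ) ∈ A := by
    have eS : p ^ (J + j + mζ) • S = p ^ (J + mζ) • (p ^ j • S) := by
      rw [smul_smul, ← pow_add, show J + mζ + j = J + j + mζ by omega]
    have eP : p ^ (J + j + mζ) • ιP = 0 := by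
      rw [show J + j + mζ = (j + mζ) + J by omega, pow_add, mul_smul, hιPJ, smul_zero]
    have eQ : p ^ (J + j + mζ) • Qζ = p ^ (J + j) • (p ^ mζ • Qζ) := by rw [smul_smul, ← pow_add]
    rw [smul_sub, smul_sub, eS, eP, eQ, sub_zero]
    exact sub_mem (AddSubgroup.nsmul_mem _ hjS _) (AddSubgroup.nsmul_mem _ hQζ _)
  rw [twistedTorsionToH1_oneCocycleClass, ← oneCocycleClass_sub]
  refine ⟨_, S - ιP - Qζ, J + j + mζ, rfl, hQ₂A, fun τ ↦ ?_⟩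
  have hτ : (τ : Field.absoluteGaloisGroup E) ∈ localSubgroupOfEmb κ.kerSubgroup ι := τ.2
  rw [Submodule.coe_sub, ContinuousMap.sub_apply, AddSubgroup.coe_sub, map_sub, contOneCocycles.push_apply,
    contOneCocycles.pullback_apply]
  change pointsMapOfEmb W ι ((φ.1 (resGalSubgroupOfEmb κ.kerSubgroup ι τ) : W.geomPrimaryTorsion p) : W.geomPoints) -
      pointsMap W E ((Y.1 (resGal (K := K) E τ.1) : MJ) : geomPoints W) = _
  -- `ι(φ(res τ)) = f0 τ = f1 τ + (τS − S)` and `ι(Y(res τ)) = ι(ξ τ) + (τ ιP − ιP) = f1 τ + (τ ιP − ιP)`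
  have e1 : pointsMapOfEmb W ι ((φ.1 (resGalSubgroupOfEmb κ.kerSubgroup ι τ) : W.geomPrimaryTorsion p) :
      W.geomPoints) = f1 τ.1 hτ + ((τ : Field.absoluteGaloisGroup E) • S - S) := by
    rw [hf1def, sub_add_cancel, hf0 τ.1 hτ]; rfl
  have e2 : pointsMap W E ((Y.1 (resGal (K := K) E τ.1) : MJ) : geomPoints W) =
      f1 τ.1 hτ + ((τ : Field.absoluteGaloisGroup E) • Qζ - Qζ) + ((τ : Field.absoluteGaloisGroup E) • ιP - ιP) := by
    have h1 := hP' τ.1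
    have h2 : Y.1 (resGal (K := K) E τ.1) = ξ.1 τ.1 + ζ.1 τ.1 + ((τ : Field.absoluteGaloisGroup E) • P - P) := by
      rw [← h1]; abel
    rw [h2, hsmulH _ hτ, AddSubgroup.coe_add, AddSubgroup.coe_add, AddSubgroup.coe_sub, map_add, map_add, map_sub,
      hξG τ.1 hτ, hζval τ, AddSubgroup.torsionBy.coe_smul, pointsMap_smul, ← hιP]
  rw [e1, e2, smul_sub, smul_sub]
  abel

end Summit.BirchSwinnertonDyer.BirchSwinnertonDyer.Theorems.SignedEC.TwistedLocalDescent

end
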